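import Mathlib
import Summits.Ventures.PercRepro2.CoinSquareCkl

/-!
# Row 2′DARC at the OR-TAIL: the inequality (OR) of the undirected square, abstract form (blind
cell PercRepro2, night-2 g8; proofs/NIGHT2-DARC.md §31)

The undirected square `s — p — a — q — s` with the tail at the OR-vertex `u = a` and the markers
on its two routes `p, q` is the smallest closed-in core whose `u`-cell is NOT ∩-closed
(§30.11/§30.13): the `u`-cell covariance is negative and the FKG/Holley route of
`darc_of_uCellLsmU` is unavailable.  Its `u`-cell bracket of `star_alg` equals `M' · (OR)` with

  (OR)  `σ₃ Λ_p̄ Λ_q̄ − σ₂ Λ_p Λ_q̄ − σ₁ Λ_q Λ_p̄ ≥ 0`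

(`σ₁ = νpa·B_pa`, `σ₂ = νqa·B_qa`, `σ₃ = νpqa·B_pqa` the gate atoms, `B_X = A(X ∪ w̃)`;
`Λ_p = Σ_{W ∋ p} ν(W) A(W)`, `Λ_p̄` its complement — the `R`-masses of the marker cells).
`square_or_abstract` is the THREE-FACTOR PAIRING: every monomial of the right-hand side is paired
into the product `σ₃ Λ_p̄ Λ_q̄` by ONE log-supermodular step `B_qa · A(W) ≤ B_pqa · A(qa ∩ W)`
(`W ∋ p`; mirror for `σ₁`), the phantom value `A({s,a}) ≤ A({s})`; the residual is the bilinear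
form `Σ_ij c_ij a_i b_j` in the two decreasing sequences `a = (A∅, Aq, Aqa)`, `b = (A∅, Ap, Apa)`,
rewritten by two-dimensional Abel summation as `Σ_kl C_kl (a_k − a_{k+1})(b_l − b_{l+1})` with
the nine rectangular partial sums `C_kl` — nonnegative for the square's cluster law
(`CoinSquareCkl.lean`).  Here the seven cluster weights are free variables `n∅, …`; the
square's values are substituted in `square_or_alg`, and `square_bracket_of_or` turns (OR) into
the `u`-cell bracket.
-/

namespace Summit.Ventures.PercRepro2.Coin

section SquareAlg

variable {R : Type*} [Field R] [LinearOrder R] [IsStrictOrderedRing R]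

/-- **The three-factor pairing**: for ANY nonnegative cluster weights `n∅, …, npqa` and any head
values (nonnegative, `A` decreasing along `∅ ⊇ …`, eight log-supermodular steps), the cleared (OR)
functional dominates `B_pqa · Σ_kl C_kl (a_k − a_{k+1})(b_l − b_{l+1})`. -/
theorem square_or_abstract (n0 np nq npq npa nqa npqa : R) (hn0 : 0 ≤ n0) (hnp : 0 ≤ np) (hnq : 0 ≤ nq) (hnpq : 0 ≤ npq)
    (hnpa : 0 ≤ npa) (hnqa : 0 ≤ nqa) (hnpqa : 0 ≤ npqa)
    (A0 Ap Aq Apq Apa Aqa Apqa Aa Bpa Bqa Bpqa : R)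
    (hA0 : 0 ≤ A0) (hAp : 0 ≤ Ap) (hAq : 0 ≤ Aq) (hApa : 0 ≤ Apa) (hAqa : 0 ≤ Aqa) (hBpqa : 0 ≤ Bpqa)
    (hAa_le : Aa ≤ A0)
    (h1 : Bqa * Ap ≤ Bpqa * A0) (h2 : Bqa * Apq ≤ Bpqa * Aq) (h3 : Bqa * Apa ≤ Bpqa * Aa)
    (h4 : Bqa * Apqa ≤ Bpqa * Aqa)
    (h5 : Bpa * Aq ≤ Bpqa * A0) (h6 : Bpa * Apq ≤ Bpqa * Ap) (h7 : Bpa * Aqa ≤ Bpqa * Aa)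
    (h8 : Bpa * Apqa ≤ Bpqa * Apa) :
    Bpqa * ((npqa * n0 * n0 - nqa * (np + npa) * n0 - npa * (nq + nqa) * n0) * ((A0 - Aq) * (A0 - Ap)) + (npqa * n0 * (n0 + np) - nqa * (np + npa) * (n0 + np) - npa * (nq + nqa + npq) * n0) * ((A0 - Aq) * (Ap - Apa)) + (npqa * n0 * (n0 + np + npa) - nqa * (np + npa) * (n0 + np + npa) - npa * (nq + nqa + npq + npqa) * n0) * ((A0 - Aq) * Apa) + (npqa * (n0 + nq) * n0 - nqa * (np + npa + npq) * n0 - npa * (nq + nqa) * (n0 + nq)) * ((Aq - Aqa) * (A0 - Ap)) + (npqa * (n0 + nq) * (n0 + np) - nqa * (np + npa + npq) * (n0 + np) - npa * (nq + nqa + npq) * (n0 + nq)) * ((Aq - Aqa) * (Ap - Apa)) + (npqa * (n0 + nq) * (n0 + np + npa) - nqa * (np + npa + npq) * (n0 + np + npa) - npa * (nq + nqa + npq + npqa) * (n0 + nq)) * ((Aq - Aqa) * Apa) + (npqa * (n0 + nq + nqa) * n0 - nqa * (np + npa + npq + npqa) * n0 - npa * (nq + nqa) * (n0 + nq + nqa))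 * (Aqa * (A0 - Ap)) + (npqa * (n0 + nq + nqa) * (n0 + np) - nqa * (np + npa + npq + npqa) * (n0 + np) - npa * (nq + nqa + npq) * (n0 + nq + nqa)) * (Aqa * (Ap - Apa)) + (npqa * (n0 + nq + nqa) * (n0 + np + npa) - nqa * (np + npa + npq + npqa) * (n0 + np + npa) - npa * (nq + nqa + npq + npqa) * (n0 + nq + nqa)) * (Aqa * Apa)) ≤ (npqa * Bpqa) * (n0 * A0 + nq * Aq + nqa * Aqa) * (n0 * A0 + np * Ap + npa * Apa) - (nqa * Bqa) * (np * Ap + npq * Apq + npa * Apa + npqa * Apqa) * (n0 * A0 + np * Ap + npa * Apa) - (npa * Bpa) * (nq * Aq + npq * Apq + nqa * Aqa + npqa * Apqa) * (n0 * A0 + nq * Aq + nqa * Aqa) := by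
  have key : (npqa * Bpqa) * (n0 * A0 + nq * Aq + nqa * Aqa) * (n0 * A0 + np * Ap + npa * Apa) - (nqa * Bqa) * (np * Ap + npq * Apq + npa * Apa + npqa * Apqa) * (n0 * A0 + np * Ap + npa * Apa) - (npa * Bpa) * (nq * Aq + npq * Apq + nqa * Aqa + npqa * Apqa) * (n0 * A0 + nq * Aq + nqa * Aqa) = Bpqa * ((npqa * n0 * n0 - nqa * (np + npa) * n0 - npa * (nq + nqa) * n0) * ((A0 - Aq) * (A0 - Ap)) + (npqa * n0 * (n0 + np) - nqa * (np + npa) * (n0 + np) - npa * (nq + nqa + npq) * n0) * ((A0 - Aq) * (Ap - Apa)) + (npqa * n0 * (n0 + np + npa) - nqa * (np + npa) * (n0 + np + npa) - npa * (nq + nqa + npq + npqa) * n0) * ((A0 - Aq) * Apa) + (npqa * (n0 + nq) * n0 - nqa * (np + npa + npq) * n0 - npa * (nq + nqa) * (n0 + nq)) * ((Aq - Aqa) * (A0 - Ap)) + (npqa * (n0 + nq) * (n0 + np) - nqa * (np + npa + npq) * (n0 + np) - npa * (nq + nqa + npq) * (n0 + nq)) * ((Aq - Aqa) * (Ap - Apa))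 + (npqa * (n0 + nq) * (n0 + np + npa) - nqa * (np + npa + npq) * (n0 + np + npa) - npa * (nq + nqa + npq + npqa) * (n0 + nq)) * ((Aq - Aqa) * Apa) + (npqa * (n0 + nq + nqa) * n0 - nqa * (np + npa + npq + npqa) * n0 - npa * (nq + nqa) * (n0 + nq + nqa)) * (Aqa * (A0 - Ap)) + (npqa * (n0 + nq + nqa) * (n0 + np) - nqa * (np + npa + npq + npqa) * (n0 + np) - npa * (nq + nqa + npq) * (n0 + nq + nqa)) * (Aqa * (Ap - Apa)) + (npqa * (n0 + nq + nqa) * (n0 + np + npa) - nqa * (np + npa + npq + npqa) * (n0 + np + npa) - npa * (nq + nqa + npq + npqa) * (n0 + nq + nqa)) * (Aqa * Apa)) + ((nqa * np * n0 * A0) * (Bpqa * A0 - Bqa * Ap) + (nqa * np * np * Ap) * (Bpqa * A0 - Bqa * Ap) + (nqa * np * npa * Apa) * (Bpqa * A0 - Bqa * Ap) + (nqa * npq * n0 * A0) * (Bpqa * Aq - Bqa * Apq) + (nqa * npq * np * Ap) * (Bpqa * Aq - Bqa * Apq) + (nqa * npq * npa * Apa) * (Bpqa * Aq - Bqa * Apq)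 + (nqa * npa * n0 * A0) * (Bpqa * Aa - Bqa * Apa) + (nqa * npa * n0 * A0) * Bpqa * (A0 - Aa) + (nqa * npa * np * Ap) * (Bpqa * Aa - Bqa * Apa) + (nqa * npa * np * Ap) * Bpqa * (A0 - Aa) + (nqa * npa * npa * Apa) * (Bpqa * Aa - Bqa * Apa) + (nqa * npa * npa * Apa) * Bpqa * (A0 - Aa) + (nqa * npqa * n0 * A0) * (Bpqa * Aqa - Bqa * Apqa) + (nqa * npqa * np * Ap) * (Bpqa * Aqa - Bqa * Apqa) + (nqa * npqa * npa * Apa) * (Bpqa * Aqa - Bqa * Apqa) + (npa * nq * n0 * A0) * (Bpqa * A0 - Bpa * Aq) + (npa * nq * nq * Aq) * (Bpqa * A0 - Bpa * Aq) + (npa * nq * nqa * Aqa) * (Bpqa * A0 - Bpa * Aq) + (npa * npq * n0 * A0) * (Bpqa * Ap - Bpa * Apq) + (npa * npq * nq * Aq) * (Bpqa * Ap - Bpa * Apq) + (npa * npq * nqa * Aqa) * (Bpqa * Ap - Bpa * Apq) + (npa * nqa * n0 * A0) * (Bpqa * Aa - Bpa * Aqa) + (npa * nqa * n0 * A0) *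 Bpqa * (A0 - Aa) + (npa * nqa * nq * Aq) * (Bpqa * Aa - Bpa * Aqa) + (npa * nqa * nq * Aq) * Bpqa * (A0 - Aa) + (npa * nqa * nqa * Aqa) * (Bpqa * Aa - Bpa * Aqa) + (npa * nqa * nqa * Aqa) * Bpqa * (A0 - Aa) + (npa * npqa * n0 * A0) * (Bpqa * Apa - Bpa * Apqa) + (npa * npqa * nq * Aq) * (Bpqa * Apa - Bpa * Apqa) + (npa * npqa * nqa * Aqa) * (Bpqa * Apa - Bpa * Apqa)) := by ring
  rw [key]
  refine le_add_of_nonneg_right ?_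
  exact (add_nonneg (add_nonneg (add_nonneg (add_nonneg (add_nonneg (add_nonneg (add_nonneg (add_nonneg (add_nonneg (add_nonneg (add_nonneg (add_nonneg (add_nonneg (add_nonneg (add_nonneg (add_nonneg (add_nonneg (add_nonneg (add_nonneg (add_nonneg (add_nonneg (add_nonneg (add_nonneg (add_nonneg (add_nonneg (add_nonneg (add_nonneg (add_nonneg (add_nonneg (mul_nonneg (by positivity) (sub_nonneg.2 h1)) (mul_nonneg (by positivity) (sub_nonneg.2 h1))) (mul_nonneg (by positivity) (sub_nonneg.2 h1))) (mul_nonneg (by positivity) (sub_nonneg.2 h2))) (mul_nonneg (by positivity) (sub_nonneg.2 h2))) (mul_nonneg (by positivity) (sub_nonneg.2 h2))) (mul_nonneg (by positivity) (sub_nonneg.2 h3))) (mul_nonneg (by positivity) (sub_nonneg.2 hAa_le))) (mul_nonneg (by positivity) (sub_nonneg.2 h3))) (mul_nonneg (by positivity) (sub_nonneg.2 hAa_le))) (mul_nonneg (by positivity) (sub_nonneg.2 h3))) (mul_nonneg (by positivity) (sub_nonneg.2 hAa_le))) (mul_nonneg (by positivity) (sub_nonneg.2 h4))) (mul_nonneg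 (by positivity) (sub_nonneg.2 h4))) (mul_nonneg (by positivity) (sub_nonneg.2 h4))) (mul_nonneg (by positivity) (sub_nonneg.2 h5))) (mul_nonneg (by positivity) (sub_nonneg.2 h5))) (mul_nonneg (by positivity) (sub_nonneg.2 h5))) (mul_nonneg (by positivity) (sub_nonneg.2 h6))) (mul_nonneg (by positivity) (sub_nonneg.2 h6))) (mul_nonneg (by positivity) (sub_nonneg.2 h6))) (mul_nonneg (by positivity) (sub_nonneg.2 h7))) (mul_nonneg (by positivity) (sub_nonneg.2 hAa_le))) (mul_nonneg (by positivity) (sub_nonneg.2 h7))) (mul_nonneg (by positivity) (sub_nonneg.2 hAa_le))) (mul_nonneg (by positivity) (sub_nonneg.2 h7))) (mul_nonneg (by positivity) (sub_nonneg.2 hAa_le))) (mul_nonneg (by positivity) (sub_nonneg.2 h8))) (mul_nonneg (by positivity) (sub_nonneg.2 h8))) (mul_nonneg (by positivity) (sub_nonneg.2 h8)))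

/-- (OR) from the nine rectangular partial sums. -/
theorem square_or_of_Ckl (n0 np nq npq npa nqa npqa : R) (hn0 : 0 ≤ n0) (hnp : 0 ≤ np) (hnq : 0 ≤ nq) (hnpq : 0 ≤ npq)
    (hnpa : 0 ≤ npa) (hnqa : 0 ≤ nqa) (hnpqa : 0 ≤ npqa)
    (A0 Ap Aq Apq Apa Aqa Apqa Aa Bpa Bqa Bpqa : R)
    (hA0 : 0 ≤ A0) (hAp : 0 ≤ Ap) (hAq : 0 ≤ Aq) (hApa : 0 ≤ Apa) (hAqa : 0 ≤ Aqa) (hBpqa : 0 ≤ Bpqa)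
    (hAq_le : Aq ≤ A0) (hAqa_le : Aqa ≤ Aq) (hAp_le : Ap ≤ A0) (hApa_le : Apa ≤ Ap) (hAa_le : Aa ≤ A0)
    (h1 : Bqa * Ap ≤ Bpqa * A0) (h2 : Bqa * Apq ≤ Bpqa * Aq) (h3 : Bqa * Apa ≤ Bpqa * Aa)
    (h4 : Bqa * Apqa ≤ Bpqa * Aqa)
    (h5 : Bpa * Aq ≤ Bpqa * A0) (h6 : Bpa * Apq ≤ Bpqa * Ap) (h7 : Bpa * Aqa ≤ Bpqa * Aa)
    (h8 : Bpa * Apqa ≤ Bpqa * Apa)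
    (hC00 : 0 ≤ (npqa * n0 * n0 - nqa * (np + npa) * n0 - npa * (nq + nqa) * n0))
    (hC01 : 0 ≤ (npqa * n0 * (n0 + np) - nqa * (np + npa) * (n0 + np) - npa * (nq + nqa + npq) * n0))
    (hC02 : 0 ≤ (npqa * n0 * (n0 + np + npa) - nqa * (np + npa) * (n0 + np + npa) - npa * (nq + nqa + npq + npqa) * n0))
    (hC10 : 0 ≤ (npqa * (n0 + nq) * n0 - nqa * (np + npa + npq) * n0 - npa * (nq + nqa) * (n0 + nq)))
    (hC11 : 0 ≤ (npqa * (n0 + nq) * (n0 + np) - nqa * (np + npa + npq) * (n0 + np) - npa * (nq + nqa + npq) * (n0 + nq)))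
    (hC12 : 0 ≤ (npqa * (n0 + nq) * (n0 + np + npa) - nqa * (np + npa + npq) * (n0 + np + npa) - npa * (nq + nqa + npq + npqa) * (n0 + nq)))
    (hC20 : 0 ≤ (npqa * (n0 + nq + nqa) * n0 - nqa * (np + npa + npq + npqa) * n0 - npa * (nq + nqa) * (n0 + nq + nqa)))
    (hC21 : 0 ≤ (npqa * (n0 + nq + nqa) * (n0 + np) - nqa * (np + npa + npq + npqa) * (n0 + np) - npa * (nq + nqa + npq) * (n0 + nq + nqa)))
    (hC22 : 0 ≤ (npqa * (n0 + nq + nqa) * (n0 + np + npa) - nqa * (np + npa + npq + npqa) * (n0 + np + npa) - npa * (nq + nqa + npq + npqa) * (n0 + nq + nqa))) :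
    0 ≤ (npqa * Bpqa) * (n0 * A0 + nq * Aq + nqa * Aqa) * (n0 * A0 + np * Ap + npa * Apa) - (nqa * Bqa) * (np * Ap + npq * Apq + npa * Apa + npqa * Apqa) * (n0 * A0 + np * Ap + npa * Apa) - (npa * Bpa) * (nq * Aq + npq * Apq + nqa * Aqa + npqa * Apqa) * (n0 * A0 + nq * Aq + nqa * Aqa) := by
  refine le_trans ?_ (square_or_abstract n0 np nq npq npa nqa npqa hn0 hnp hnq hnpq hnpa hnqa hnpqa
    A0 Ap Aq Apq Apa Aqa Apqa Aa Bpa Bqa Bpqa hA0 hAp hAq hApa hAqa hBpqa hAa_le h1 h2 h3 h4 h5 h6 h7 h8)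
  exact mul_nonneg hBpqa (add_nonneg (add_nonneg (add_nonneg (add_nonneg (add_nonneg (add_nonneg (add_nonneg (add_nonneg (mul_nonneg hC00 (mul_nonneg (sub_nonneg.2 hAq_le) (sub_nonneg.2 hAp_le))) (mul_nonneg hC01 (mul_nonneg (sub_nonneg.2 hAq_le) (sub_nonneg.2 hApa_le)))) (mul_nonneg hC02 (mul_nonneg (sub_nonneg.2 hAq_le) hApa))) (mul_nonneg hC10 (mul_nonneg (sub_nonneg.2 hAqa_le) (sub_nonneg.2 hAp_le)))) (mul_nonneg hC11 (mul_nonneg (sub_nonneg.2 hAqa_le) (sub_nonneg.2 hApa_le)))) (mul_nonneg hC12 (mul_nonneg (sub_nonneg.2 hAqa_le) hApa))) (mul_nonneg hC20 (mul_nonneg hAqa (sub_nonneg.2 hAp_le)))) (mul_nonneg hC21 (mul_nonneg hAqa (sub_nonneg.2 hApa_le)))) (mul_nonneg hC22 (mul_nonneg hAqa hApa)))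

/-- **(OR) on the undirected square** (cluster weights = the square's homogeneous polynomials). -/
theorem square_or_alg (α α' β β' γ γ' δ δ' : R) (hα : 0 ≤ α) (hα' : 0 ≤ α') (hβ : 0 ≤ β) (hβ' : 0 ≤ β')
    (hγ : 0 ≤ γ) (hγ' : 0 ≤ γ') (hδ : 0 ≤ δ) (hδ' : 0 ≤ δ')
    (A0 Ap Aq Apq Apa Aqa Apqa Aa Bpa Bqa Bpqa : R)
    (hA0 : 0 ≤ A0) (hAp : 0 ≤ Ap) (hAq : 0 ≤ Aq) (hApa : 0 ≤ Apa) (hAqa : 0 ≤ Aqa) (hBpqa : 0 ≤ Bpqa)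
    (hAq_le : Aq ≤ A0) (hAqa_le : Aqa ≤ Aq) (hAp_le : Ap ≤ A0) (hApa_le : Apa ≤ Ap) (hAa_le : Aa ≤ A0)
    (h1 : Bqa * Ap ≤ Bpqa * A0) (h2 : Bqa * Apq ≤ Bpqa * Aq) (h3 : Bqa * Apa ≤ Bpqa * Aa)
    (h4 : Bqa * Apqa ≤ Bpqa * Aqa)
    (h5 : Bpa * Aq ≤ Bpqa * A0) (h6 : Bpa * Apq ≤ Bpqa * Ap) (h7 : Bpa * Aqa ≤ Bpqa * Aa)
    (h8 : Bpa * Apqa ≤ Bpqa * Apa) :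
    0 ≤ ((α' * β * γ * δ + α * β' * γ * δ + α * β * γ' * δ + α * β * γ * δ' + α * β * γ * δ) * Bpqa) * ((α' * β' * γ' * δ' + α' * β' * γ' * δ + α' * β' * γ * δ' + α' * β' * γ * δ) * A0 + (α' * β * γ' * δ' + α' * β * γ * δ') * Aq + α' * β * γ' * δ * Aqa) * ((α' * β' * γ' * δ' + α' * β' * γ' * δ + α' * β' * γ * δ' + α' * β' * γ * δ) * A0 + (α * β' * γ' * δ' + α * β' * γ' * δ) * Ap + α * β' * γ * δ' * Apa) - (α' * β * γ' * δ * Bqa) * ((α * β' * γ' * δ' + α * β' * γ' * δ) * Ap + α * β * γ' * δ' * Apq + α * β' * γ * δ' * Apa + (α' * β * γ * δ + α * β' * γ * δ + α * β * γ' * δ + α * β * γ * δ' + α * β * γ * δ) * Apqa) * ((α' * β' * γ' * δ' + α' * β' * γ' * δ + α' * β' * γ * δ' + α' * β' * γ * δ) * A0 + (α * β' * γ' * δ' + α * β' * γ' * δ) * Ap + α * β' * γ * δ' * Apa) - (α * β' * γ * δ' * Bpa) * ((α' * β * γ' * δ' + α' * β * γ * δ') * Aq + α * β * γ' * δ' *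 Apq + α' * β * γ' * δ * Aqa + (α' * β * γ * δ + α * β' * γ * δ + α * β * γ' * δ + α * β * γ * δ' + α * β * γ * δ) * Apqa) * ((α' * β' * γ' * δ' + α' * β' * γ' * δ + α' * β' * γ * δ' + α' * β' * γ * δ) * A0 + (α' * β * γ' * δ' + α' * β * γ * δ') * Aq + α' * β * γ' * δ * Aqa) :=
  square_or_of_Ckl _ _ _ _ _ _ _ (by positivity) (by positivity) (by positivity) (by positivity)
    (by positivity) (by positivity) (by positivity)
    A0 Ap Aq Apq Apa Aqa Apqa Aa Bpa Bqa Bpqa hA0 hAp hAq hApa hAqa hBpqa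
    hAq_le hAqa_le hAp_le hApa_le hAa_le h1 h2 h3 h4 h5 h6 h7 h8
    (square_C00_nonneg α α' β β' γ γ' δ δ' hα hα' hβ hβ' hγ hγ' hδ hδ')
    (square_C01_nonneg α α' β β' γ γ' δ δ' hα hα' hβ hβ' hγ hγ' hδ hδ')
    (square_C02_nonneg α α' β β' γ γ' δ δ' hα hα' hβ hβ' hγ hγ' hδ hδ')
    (square_C10_nonneg α α' β β' γ γ' δ δ' hα hα' hβ hβ' hγ hγ' hδ hδ')
    (square_C11_nonneg α α' β β' γ γ' δ δ' hα hα' hβ hβ' hγ hγ' hδ hδ')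
    (square_C12_nonneg α α' β β' γ γ' δ δ' hα hα' hβ hβ' hγ hγ' hδ hδ')
    (square_C20_nonneg α α' β β' γ γ' δ δ' hα hα' hβ hβ' hγ hγ' hδ hδ')
    (square_C21_nonneg α α' β β' γ γ' δ δ' hα hα' hβ hβ' hγ hγ' hδ hδ')
    (square_C22_nonneg α α' β β' γ γ' δ δ' hα hα' hβ hβ' hγ hγ' hδ hδ')

/-- **The `u`-cell bracket of `star_alg` is `M' · (OR)`** on the square (`u = a`, markers `p, q`):
with the `u`-absent cell `M₀, X₀, Y₀, XY₀`, the `u`-present `R`-cell `M₁, X₁, Y₁` and the gate cell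
`M', X', Y', XY'` written out in the cluster weights, `Λ² (M' XY' − X' Y') + (Λ X' − F̄_a M')(Λ Y' − F̄_b M')
= M' · (OR)`; hence the bracket is nonnegative. -/
theorem square_bracket_of_or (n0 np nq npq npa nqa npqa A0 Ap Aq Apq Apa Aqa Apqa Bpa Bqa Bpqa : R)
    (hM' : 0 ≤ ((npa * Bpa) + (nqa * Bqa) + (npqa * Bpqa)))
    (hOR : 0 ≤ (npqa * Bpqa) * (n0 * A0 + nq * Aq + nqa * Aqa) * (n0 * A0 + np * Ap + npa * Apa) - (nqa * Bqa) * (np * Ap + npq * Apq + npa * Apa + npqa * Apqa) * (n0 * A0 + np * Ap + npa * Apa) - (npa * Bpa) * (nq * Aq + npq * Apq + nqa * Aqa + npqa * Apqa) * (n0 * A0 + nq * Aq + nqa * Aqa)) :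
    0 ≤ ((n0 * A0 + np * Ap + nq * Aq + npq * Apq) + (npa * Apa + nqa * Aqa + npqa * Apqa)) ^ 2 * (((npa * Bpa) + (nqa * Bqa) + (npqa * Bpqa)) * (npqa * Bpqa) - ((npa * Bpa) + (npqa * Bpqa)) * ((nqa * Bqa) + (npqa * Bpqa))) + (((n0 * A0 + np * Ap + nq * Aq + npq * Apq) + (npa * Apa + nqa * Aqa + npqa * Apqa)) * ((npa * Bpa) + (npqa * Bpqa)) - ((np * Ap + npq * Apq) + (npa * Apa + npqa * Apqa)) * ((npa * Bpa) + (nqa * Bqa) + (npqa * Bpqa))) * (((n0 * A0 + np * Ap + nq * Aq + npq * Apq) + (npa * Apa + nqa * Aqa + npqa * Apqa)) * ((nqa * Bqa) + (npqa * Bpqa)) - ((nq * Aq + npq * Apq) + (nqa * Aqa + npqa * Apqa)) * ((npa * Bpa) + (nqa * Bqa) + (npqa * Bpqa))) := by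
  have key : ((n0 * A0 + np * Ap + nq * Aq + npq * Apq) + (npa * Apa + nqa * Aqa + npqa * Apqa)) ^ 2 * (((npa * Bpa) + (nqa * Bqa) + (npqa * Bpqa)) * (npqa * Bpqa) - ((npa * Bpa) + (npqa * Bpqa)) * ((nqa * Bqa) + (npqa * Bpqa))) + (((n0 * A0 + np * Ap + nq * Aq + npq * Apq) + (npa * Apa + nqa * Aqa + npqa * Apqa)) * ((npa * Bpa) + (npqa * Bpqa)) - ((np * Ap + npq * Apq) + (npa * Apa + npqa * Apqa)) * ((npa * Bpa) + (nqa * Bqa) + (npqa * Bpqa))) * (((n0 * A0 + np * Ap + nq * Aq + npq * Apq) + (npa * Apa + nqa * Aqa + npqa * Apqa)) * ((nqa * Bqa) + (npqa * Bpqa)) - ((nq * Aq + npq * Apq) + (nqa * Aqa + npqa * Apqa)) * ((npa * Bpa) + (nqa * Bqa) + (npqa * Bpqa))) = ((npa * Bpa) + (nqa * Bqa) + (npqa * Bpqa)) * ((npqa * Bpqa) * (n0 * A0 + nq * Aq + nqa * Aqa) * (n0 * A0 + np * Ap + npa * Apa) - (nqa * Bqa) * (np * Ap + npq * Apq + npa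 * Apa + npqa * Apqa) * (n0 * A0 + np * Ap + npa * Apa) - (npa * Bpa) * (nq * Aq + npq * Apq + nqa * Aqa + npqa * Apqa) * (n0 * A0 + nq * Aq + nqa * Aqa)) := by ring
  rw [key]
  exact mul_nonneg hM' hOR

end SquareAlg

end Summit.Ventures.PercRepro2.Coin
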